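import Summits.QuantumFields.YangMills.Theses.BackwardLiouvilleRigidity
import Literature.MathematicalPhysics.QuantumFieldTheory.Balaban1983to89.T3OrbitAverage

/-!
# Route `BackwardLiouvilleRigidity` — crux `ClassLimitTrajectories` (stmt-QuantumFields-22541), registered stub
# `stub_heightwiseRealisation` PROVED: HEIGHTWISE COMPACTNESS OF THE NESTED CUT-OFF LAWS and realisation of the level-0 loop
# expectations

Cell `ym-idea-1` width seat `ym-line-sfw-p2-w3` gen 27 (free hands), for the line «backward-liouville-rigidity» of planner
`ym-r3-idea-1` g10 (skeleton `Cruxes/FluctuationComparisonRegPrIntL/Lines/backward_liouville_classlimit.lean`, two registered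
stubs; THIS FILE discharges the measure-theoretic one BY NAME AND SIGNATURE, `stub_heightwiseRealisation`, §4).  Rung R3 of the
YM ladder (continuum `SU(2)` Yang–Mills on the three-torus) is a RECORD rung, NOT the Clay problem; nothing here proves the crux,
the route, the rung or a mass gap — the Bałaban content of the crux is the OTHER stub (`stub_fineClassClosure`).

THE STATEMENT.  For a family `F`, a coupling `γ > 0` and a strictly monotone cut-off subsequence `φ`, there is a further
subsequence `ψ` and probability measures `μ_j` on every height `j` (configurations `SU(2)^{bonds}` of the lattice `F.P j`) such
that the NESTED cut-off laws `λ_{i,j}` — run `K_i = φ(ψ(i))`'s Wilson–Gibbs measure descended by Bałaban's one-step maps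
`descend F ℰp j` (one (0.4) block averaging + level identification, tree `T3NestedUnitLaws`) to every height `j ≤ K_i` — converge
weakly at EVERY height (`∫ f dλ_{i,j} → ∫ f dμ_j` for every continuous `f`), and the level-0 joint loop expectations
`expectAt K_i os` converge to `∫ ∏ loopAt dμ_0`.

THE ARGUMENT (compactness bookkeeping only).
* §1 `exists_nestedLaws`: the nested laws exist as a total family `ν K j` of PROBABILITY measures with `ν K K = Gibbs_K` and
  `ν K j = (descend j)_* ν K (j+1)` for `j < K` (finite downward recursion realised with `Function.update`; `j > K` is harmless
  filler `Gibbs_j`).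
* §2 `integral_prod_avgObs_nestedLaw`: for `j ≤ K`, `∫ ∏_{C∈os} avgObs j C dν K j = expectAt K os` — downward induction from
  `T3NestedUnitLaws.expectAt_eq_integral_gibbs` with `avgObs (j+1) C = avgObs j C ∘ descend j`
  (`T3NestedUnitLaws.avgObs_succ_eq_avgObs_descend`); at `j = 0`, `avgObs 0 C u = loopAt u (C.atLevel 0)` definitionally.
* §3 `exists_subseq_tendsto_pi_probabilityMeasure`: a sequence in the countable product `Π_j ProbabilityMeasure(X_j)` of the
  spaces of Borel probability measures on compact metrisable spaces `X_j` has a convergent subsequence — Mathlib's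
  `CompactSpace (ProbabilityMeasure _)` (Riesz–Markov) and Lévy–Prokhorov pseudo-metrisability per factor, Tychonoff and first
  countability of countable products, `SeqCompactSpace.tendsto_subseq`.  ONE subsequence serves every height (no hand-made
  diagonal argument).
* §4 the stub: weak convergence at height `j` gives the integrals of continuous (hence bounded) functions
  (`ProbabilityMeasure.tendsto_iff_forall_integral_tendsto`, `BoundedContinuousFunction.mkOfCompact`), and §2 at `j = 0` turns
  the height-0 statement into the convergence of `expectAt`.

References: T. Bałaban, CMP **102** (1985) 255–275 [Balaban1985UV3] ((1)–(3) p. 256: the approximations and `ρ_{k+1} = Tρ_k`);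
T. Bałaban, CMP **109** (1987) 249–301 [Balaban1987RG1] ((0.4)/(0.11) p. 253: the averaging and its level homogeneity);
P. Billingsley, *Convergence of Probability Measures*, 2nd ed. (Wiley 1999), Thm 5.1 (Prokhorov) — here only the compact case.
-/

noncomputable section

open MeasureTheory Filter Set
open scoped Topology BoundedContinuousFunction
open Literature.MathematicalPhysics.QuantumFieldTheory.Balaban1983to89
open Literature.MathematicalPhysics.QuantumFieldTheory.Balaban1983to89.T3ContinuumYM3Torus
open Literature.MathematicalPhysics.QuantumFieldTheory.Balaban1983to89.T3NestedUnitLaws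
open Literature.MathematicalPhysics.QuantumFieldTheory.Balaban1983to89.T3UnitLawDensityEML (ℰp measurableE_ℰp)
open Literature.MathematicalPhysics.QuantumFieldTheory.Balaban1983to89.T3OrbitAverage
open Literature.MathematicalPhysics.QuantumFieldTheory.Balaban1983to89.T4Continuum (loopAt)

namespace Summit.QuantumFields.YangMills.Theorems.BackwardLiouvilleRigidityHeightwiseRealisation

/-! ## §1 The nested cut-off laws as a total family of probability measures -/

section Nested

variable (F : T3Family) {γ : ℝ}

/-- **THE NESTED CUT-OFF LAWS EXIST**: a total family `ν K j` of probability measures on the heights `j` with `ν K K = Gibbs_K`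
(run `K`'s Wilson measure at `β_K = (γε_K)⁻¹`) and `ν K j = (descend j)_* ν K (j+1)` for every `j < K`; the values at `j > K`
are filler (`Gibbs_j`). [cite: Balaban1985UV3, (1)-(3) p.256] -/
theorem exists_nestedLaws (hγ : 0 ≤ γ) :
    ∃ ν : ℕ → (j : ℕ) → Measure (GaugeField (F.P j) 0 (Matrix.specialUnitaryGroup (Fin 2) ℂ)),
      (∀ K, ν K K = T4GenFunBounds.gibbsMeasure (F.P K) ((F.scheme ℰp γ).β K)) ∧
      (∀ K j, j < K → ν K j = Measure.map (descend F ℰp j) (ν K (j + 1))) ∧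
      (∀ K j, IsProbabilityMeasure (ν K j)) := by
  have hprob : ∀ j, IsProbabilityMeasure
      (T4GenFunBounds.gibbsMeasure (G := Matrix.specialUnitaryGroup (Fin 2) ℂ) (F.P j) ((F.scheme ℰp γ).β j)) :=
    fun j => T4GenFunBounds.isProbabilityMeasure_gibbsMeasure _ (F.scheme_β_nonneg ℰp hγ j)
  have hK : ∀ K : ℕ, ∃ g : (j : ℕ) → Measure (GaugeField (F.P j) 0 (Matrix.specialUnitaryGroup (Fin 2) ℂ)),
      g K = T4GenFunBounds.gibbsMeasure (F.P K) ((F.scheme ℰp γ).β K) ∧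
      (∀ j, j < K → g j = Measure.map (descend F ℰp j) (g (j + 1))) ∧ ∀ j, IsProbabilityMeasure (g j) := by
    intro K
    -- agreement of the recursion on the heights `K - n ≤ j < K`, by induction on `n`
    have step : ∀ n : ℕ, ∃ g : (j : ℕ) → Measure (GaugeField (F.P j) 0 (Matrix.specialUnitaryGroup (Fin 2) ℂ)),
        g K = T4GenFunBounds.gibbsMeasure (F.P K) ((F.scheme ℰp γ).β K) ∧
        (∀ j, j < K → K ≤ j + n → g j = Measure.map (descend F ℰp j) (g (j + 1))) ∧
        ∀ j, IsProbabilityMeasure (g j) := by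
      intro n
      induction n with
      | zero =>
        exact ⟨fun j => T4GenFunBounds.gibbsMeasure (F.P j) ((F.scheme ℰp γ).β j), rfl,
          fun j hj hle => absurd hle (by omega), hprob⟩
      | succ n ih =>
        obtain ⟨g, hgK, hg, hp⟩ := ih
        by_cases hn : n + 1 ≤ K
        · obtain ⟨j₀, hj₀⟩ : ∃ j₀ : ℕ, j₀ = K - (n + 1) := ⟨_, rfl⟩
          haveI : IsProbabilityMeasure (g (j₀ + 1)) := hp _
          refine ⟨Function.update g j₀ (Measure.map (descend F ℰp j₀) (g (j₀ + 1))), ?_, ?_, ?_⟩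
          · rw [Function.update_of_ne (by omega : K ≠ j₀)]
            exact hgK
          · intro j hj hle
            by_cases hjj : j = j₀
            · subst hjj
              rw [Function.update_self, Function.update_of_ne (by omega : j + 1 ≠ j)]
            · rw [Function.update_of_ne hjj, Function.update_of_ne (by omega : j + 1 ≠ j₀)]
              exact hg j hj (by omega)
          · intro j
            by_cases hjj : j = j₀
            · subst hjj
              rw [Function.update_self]
              exact Measure.isProbabilityMeasure_map (measurable_descend F ℰp measurableE_ℰp j).aemeasurable
            · rw [Function.update_of_ne hjj]
              exact hp j
        · exact ⟨g, hgK, fun j hj hle => hg j hj (by omega), hp⟩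
    obtain ⟨g, h1, h2, h3⟩ := step K
    exact ⟨g, h1, fun j hj => h2 j hj (by omega), h3⟩
  choose ν h1 h2 h3 using hK
  exact ⟨ν, h1, h2, h3⟩

/-! ## §2 The joint loop expectations of run `K` are the moments of every nested law of run `K` -/

/-- **`⟨∏ W̄⟩_K = ∫ ∏_C avgObs j C dν K j` FOR EVERY HEIGHT `j ≤ K`**: the averaged loop variables of step `j` composed with the
descents reproduce those of step `K` (`avgObs (j+1) C = avgObs j C ∘ descend j`, the level homogeneity (0.11) of
[Balaban1987RG1]), so run `K`'s joint expectations are the integrals against the nested law at every height.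
[cite: Balaban1987RG1, (0.4)/(0.11) p.253] -/
theorem integral_prod_avgObs_nestedLaw (hγ : 0 ≤ γ)
    (ν : ℕ → (j : ℕ) → Measure (GaugeField (F.P j) 0 (Matrix.specialUnitaryGroup (Fin 2) ℂ)))
    (h1 : ∀ K, ν K K = T4GenFunBounds.gibbsMeasure (F.P K) ((F.scheme ℰp γ).β K))
    (h2 : ∀ K j, j < K → ν K j = Measure.map (descend F ℰp j) (ν K (j + 1)))
    (K : ℕ) (os : List (ULoop3 F)) :
    ∀ j, j ≤ K → ∫ u, (os.map fun C => F.avgObs ℰp j C u).prod ∂(ν K j) = (F.scheme ℰp γ).expectAt K os := by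
  have hmeas : ∀ j, Measurable fun u : GaugeField (F.P j) 0 (Matrix.specialUnitaryGroup (Fin 2) ℂ) =>
      (os.map fun C => F.avgObs ℰp j C u).prod := by
    intro j
    induction os with
    | nil => simp
    | cons C l ih =>
      show Measurable fun u => F.avgObs ℰp j C u * (l.map fun C => F.avgObs ℰp j C u).prod
      exact (F.measurable_avgObs (F.avgMeasurable_of_measurableE ℰp measurableE_ℰp) j C).mul ih
  -- downward induction on the height, written as induction on `d = K - j`
  suffices h : ∀ d j, j + d = K →
      ∫ u, (os.map fun C => F.avgObs ℰp j C u).prod ∂(ν K j) = (F.scheme ℰp γ).expectAt K os from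
    fun j hj => h (K - j) j (by omega)
  intro d
  induction d with
  | zero =>
    intro j hj
    rw [add_zero] at hj
    subst hj
    rw [h1, T3NestedUnitLaws.expectAt_eq_integral_gibbs (F := F) (ℰ := ℰp) hγ j os]
  | succ d ih =>
    intro j hj
    rw [h2 K j (by omega), integral_map (measurable_descend F ℰp measurableE_ℰp j).aemeasurable
      (hmeas j).aestronglyMeasurable, ← ih (j + 1) (by omega)]
    refine integral_congr_ae (Eventually.of_forall fun U => ?_)
    show (os.map fun C => F.avgObs ℰp j C (descend F ℰp j U)).prod = (os.map fun C => F.avgObs ℰp (j + 1) C U).prod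
    simp_rw [avgObs_succ_eq_avgObs_descend]

/-- At height `0` the averaged loop variable IS the loop variable of the unit field (`avg^0 = id`, definitional).
[cite: Balaban1987RG1, (0.2)/(0.4) p.252] -/
theorem avgObs_zero (C : ULoop3 F) (u : GaugeField (F.P 0) 0 (Matrix.specialUnitaryGroup (Fin 2) ℂ)) :
    F.avgObs ℰp 0 C u = loopAt u (C.1.atLevel 0) := rfl

end Nested

/-! ## §3 Sequential compactness of countable products of spaces of probability measures on compact metrisable spaces -/

/-- **ONE SUBSEQUENCE FOR ALL HEIGHTS**: a sequence in `Π_j ProbabilityMeasure (X j)`, `j ∈ ℕ`, every `X j` compact, Hausdorff,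
second countable (pseudo-)metrisable and Borel, has a subsequence converging in the product of the weak topologies
(Riesz–Markov compactness of each factor, Lévy–Prokhorov pseudo-metrisability, Tychonoff, first countability of countable
products). [cite: Billingsley1999, Thm 5.1] -/
theorem exists_subseq_tendsto_pi_probabilityMeasure {X : ℕ → Type*} [∀ j, TopologicalSpace (X j)]
    [∀ j, MeasurableSpace (X j)] [∀ j, CompactSpace (X j)] [∀ j, T2Space (X j)]
    [∀ j, TopologicalSpace.PseudoMetrizableSpace (X j)] [∀ j, SecondCountableTopology (X j)] [∀ j, BorelSpace (X j)]
    (S : ℕ → (j : ℕ) → ProbabilityMeasure (X j)) :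
    ∃ (a : (j : ℕ) → ProbabilityMeasure (X j)) (ψ : ℕ → ℕ), StrictMono ψ ∧ Tendsto (S ∘ ψ) atTop (𝓝 a) :=
  SeqCompactSpace.tendsto_subseq S

/-! ## §4 The registered stub, by name and signature -/

/-- **HEIGHTWISE REALISATION** (registered stub `stub_heightwiseRealisation` of the skeleton
`Cruxes/FluctuationComparisonRegPrIntL/Lines/backward_liouville_classlimit.lean` for crux `ClassLimitTrajectories`,
stmt-QuantumFields-22541): every strictly monotone cut-off subsequence has a further subsequence along which the NESTED
cut-off laws converge weakly at every height to probability measures, and the level-0 joint loop expectations converge to the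
integrals against the height-0 limit.  Compactness bookkeeping only — no consistency, no densities, no rate. [cite: Balaban1985UV3, (1)-(3) p.256] -/
theorem stub_heightwiseRealisation : open MeasureTheory Filter Topology Literature.MathematicalPhysics.QuantumFieldTheory.Balaban1983to89 T3ContinuumYM3Torus T3NestedUnitLaws T3UnitLawDensityEML T4Continuum BalabanUVClass T3UnitScaleTilt in ∀ (F : T3Family) (γ : ℝ), 0 < γ → ∀ φ : ℕ → ℕ, StrictMono φ → ∃ ψ : ℕ → ℕ, StrictMono ψ ∧ ∃ μ : ((j : ℕ) → MeasureTheory.Measure (GaugeField (F.P j) 0 ↥(Matrix.specialUnitaryGroup (Fin 2) ℂ))), (∀ j : ℕ, IsProbabilityMeasure (μ j)) ∧ (∃ lam : (i j : ℕ) → MeasureTheory.Measure (GaugeField (F.P j) 0 ↥(Matrix.specialUnitaryGroup (Fin 2) ℂ)), (∀ i, lam i ((φ ∘ ψ) i) = T4GenFunBounds.gibbsMeasure (F.P ((φ ∘ ψ) i)) ((F.scheme ℰp γ).β ((φ ∘ ψ) i))) ∧ (∀ i j, j < (φ ∘ ψ) i → lam i j = Measure.map (descend F ℰp j) (lam i (j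 + 1))) ∧ (∀ (j : ℕ) (f : GaugeField (F.P j) 0 ↥(Matrix.specialUnitaryGroup (Fin 2) ℂ) → ℝ), Continuous f → Tendsto (fun i => ∫ U, f U ∂(lam i j)) atTop (𝓝 (∫ U, f U ∂(μ j))))) ∧ (StrictMono (φ ∘ ψ) ∧ ∀ os : List (ULoop3 F), Tendsto (fun i => (F.scheme ℰp γ).expectAt ((φ ∘ ψ) i) os) atTop (𝓝 (∫ u, (os.map fun C => loopAt u (C.1.atLevel 0)).prod ∂(μ 0)))) := by
  intro F γ hγ φ hφ
  obtain ⟨ν, h1, h2, h3⟩ := exists_nestedLaws F hγ.le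
  -- the nested laws of run `φ k`, bundled heightwise as one point of the product of the spaces of probability measures
  let S : ℕ → (j : ℕ) → ProbabilityMeasure (GaugeField (F.P j) 0 (Matrix.specialUnitaryGroup (Fin 2) ℂ)) :=
    fun k j => ⟨ν (φ k) j, h3 (φ k) j⟩
  obtain ⟨a, ψ, hψ, ha⟩ := exists_subseq_tendsto_pi_probabilityMeasure S
  have hconv : ∀ (j : ℕ) (f : GaugeField (F.P j) 0 (Matrix.specialUnitaryGroup (Fin 2) ℂ) → ℝ), Continuous f →
      Tendsto (fun i => ∫ U, f U ∂(ν (φ (ψ i)) j)) atTop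
        (𝓝 (∫ U, f U ∂((a j : ProbabilityMeasure _) : Measure (GaugeField (F.P j) 0 (Matrix.specialUnitaryGroup (Fin 2) ℂ))))) := by
    intro j f hf
    have hj : Tendsto (fun i => S (ψ i) j) atTop (𝓝 (a j)) := (tendsto_pi_nhds.mp ha) j
    exact (ProbabilityMeasure.tendsto_iff_forall_integral_tendsto.mp hj) (BoundedContinuousFunction.mkOfCompact ⟨f, hf⟩)
  refine ⟨ψ, hψ, fun j => ((a j : ProbabilityMeasure _) : Measure _), fun j => inferInstance, ?_, hφ.comp hψ, ?_⟩
  · exact ⟨fun i j => ν (φ (ψ i)) j, fun i => h1 _, fun i j hj => h2 _ j hj, hconv⟩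
  · intro os
    have hcont : Continuous fun u : GaugeField (F.P 0) 0 (Matrix.specialUnitaryGroup (Fin 2) ℂ) =>
        (os.map fun C : ULoop3 F => loopAt u (C.1.atLevel 0)).prod := by
      induction os with
      | nil => simpa using continuous_const
      | cons C l ih =>
        show Continuous fun u : GaugeField (F.P 0) 0 (Matrix.specialUnitaryGroup (Fin 2) ℂ) =>
          loopAt u (C.1.atLevel 0) * (l.map fun C : ULoop3 F => loopAt u (C.1.atLevel 0)).prod
        exact (continuous_loopAt _).mul ih
    refine (hconv 0 _ hcont).congr' (Eventually.of_forall fun i => ?_)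
    show ∫ U, (os.map fun C : ULoop3 F => loopAt U (C.1.atLevel 0)).prod ∂(ν (φ (ψ i)) 0) =
      (F.scheme ℰp γ).expectAt ((φ ∘ ψ) i) os
    rw [← integral_prod_avgObs_nestedLaw F hγ.le ν h1 h2 ((φ ∘ ψ) i) os 0 (Nat.zero_le _)]
    rfl

end Summit.QuantumFields.YangMills.Theorems.BackwardLiouvilleRigidityHeightwiseRealisation

end
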